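import Summits.CriticalPhenomena.Ising3D.Control2DIndexL15
import HarnessLib

/-!
# The Λ = 19 index list of the 2D γ-certificates
(cell `pub-ising3x`, seat controls-1 gen 18; KERNEL PATH for the 2D γ-certificates, Λ = 19 — CONTROL-ONLY scaffolding)

HONEST FRAMING: lottery ticket; floor = tightest certified 3D Ising CFT bounds; no exact-solution
claim without a proof. Nothing about any CFT is asserted here.

Every Λ = 19 derivative functional of the cell (RB-5/RB-6/RB-7 certificates `j129766` (gap `1.00005`), `j135119`,
`j136729`, `j141725` (boxes `[0.975, 0.99]`), the `ope2` pair `j137089`/`j137649`; E₀ = 48, format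
`deriv-functional-2d/1,2,4`) is a table on the same 55 pairs `(m, n)` with `m > n`, `m + n` odd `≤ 19` (the certificates'
`index_set`, in their order): `slL15` followed by the nine pairs with `m + n = 17` and the ten pairs with `m + n = 19`.
Shared by all future Λ = 19 table / cells / assembly files (successor work: the Λ = 19 kernel replays need the
`k ≤ 19` literal library and truncations measured per spin, HOME/pub-ising3x-controls-1/KP5/README).
-/

namespace Summit.CriticalPhenomena.Ising3D.Control2D

/-- The Λ = 19 index list: the 55 pairs `(m, n)`, `m > n`, `m + n` odd `≤ 19`. [folklore] -/
def slL19 : List (ℕ × ℕ) := [(1, 0), (3, 0), (2, 1), (5, 0), (4, 1), (3, 2), (7, 0), (6, 1), (5, 2), (4, 3),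
  (9, 0), (8, 1), (7, 2), (6, 3), (5, 4), (11, 0), (10, 1), (9, 2), (8, 3), (7, 4), (6, 5),
  (13, 0), (12, 1), (11, 2), (10, 3), (9, 4), (8, 5), (7, 6),
  (15, 0), (14, 1), (13, 2), (12, 3), (11, 4), (10, 5), (9, 6), (8, 7),
  (17, 0), (16, 1), (15, 2), (14, 3), (13, 4), (12, 5), (11, 6), (10, 7), (9, 8),
  (19, 0), (18, 1), (17, 2), (16, 3), (15, 4), (14, 5), (13, 6), (12, 7), (11, 8), (10, 9)]

/-- [folklore] -/
theorem slL19_nodup : slL19.Nodup := by decide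

/-- [folklore] -/
theorem slL19_deg : ∀ p ∈ slL19, p.1 + p.2 ≤ 19 := by decide

/-- `slL19` extends `slL15`. [folklore] -/
theorem slL19_eq_append :
    slL19 = slL15 ++ [(17, 0), (16, 1), (15, 2), (14, 3), (13, 4), (12, 5), (11, 6), (10, 7), (9, 8),
      (19, 0), (18, 1), (17, 2), (16, 3), (15, 4), (14, 5), (13, 6), (12, 7), (11, 8), (10, 9)] := rfl

end Summit.CriticalPhenomena.Ising3D.Control2D
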